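import Summits.MatrixMultiplication.OmegaCensus.SmallFormats.MatMul22nLoadedPlaneStructure
import HarnessLib

/-!
# ω-census family (a): a 2-dimensional cheap plane makes the Y-forms of its 4 terms LINEARLY INDEPENDENT (any field)

Cell `pub-omega` (unit `pub-omega-tensor`, gen 39), topic `Summits/MatrixMultiplication/OmegaCensus` (sub-folder
`SmallFormats`). Framing (verbatim): lottery ticket; floor = certified bounds/negative ranges. HONEST FRAMING: the equality half of
tensor g39's `CheapSpans.gRow_mem_span` (p729281) exported as its own statement — the skeleton layer of the «skeleton-first» design of
ALL4-SAT-g39 §8 needs it as a necessary condition: with a 2-dim cheap plane `c 0, c 1` for a 4-set `S`, the four Y-forms `g_s` (`s ∈ S`)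
are linearly independent (so their coefficient blocks `H_s ∈ M₂` form a basis of `k² ⊗ span(c 0, c 1)`). Any field; nothing on `ω`.

Proof: the four row forms `Y ↦ ∑_i c_m(i) Y_{κ i}` are independent and lie in `span{g_s : s ∈ S}` (`rowForm_eq_sum`), so that span
has `finrank ≥ 4 = |S|`, which for a 4-element family means independence (`linearIndependent_iff_card_le_finrank_span`).
-/

namespace Summit.MatrixMultiplication.OmegaCensus.SmallFormats

open Finset Module Matrix
open Literature.Computability.AlgebraicComplexity

namespace CheapSpans

variable {k : Type*} [Field k] {n : ℕ} {ι : Type*} [Fintype ι]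

/-- **Cheap 2-plane ⇒ the four Y-forms of the plane are linearly independent.** -/
theorem gForms_linearIndependent (β : BilinComp (mulBilin k 2 2 n) ι) (ν : Fin 2 → k) (hν : ν ≠ 0) (S : Finset ι)
    (hS4 : S.card = 4) (c : Fin 2 → (Fin n → k)) (hind : ∀ a : Fin 2 → k, ∑ m, a m • c m = 0 → ∀ m, a m = 0)
    (hcheap : ∀ t, t ∉ S → ∀ m, ∑ i, c m i * (Matrix.vecMul ν (β.w t)) i = 0) :
    LinearIndependent k (fun s : S => β.g s) := by
  classical
  -- the four row forms as linear functionals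
  let Φ : Fin 2 × Fin 2 → Module.Dual k (Matrix (Fin 2) (Fin n) k) := fun p =>
    { toFun := fun Y => ∑ i, c p.2 i * Y p.1 i
      map_add' := fun Y Y' => by simp only [Matrix.add_apply, mul_add, Finset.sum_add_distrib]
      map_smul' := fun a Y => by
        simp only [Matrix.smul_apply, smul_eq_mul, RingHom.id_apply, Finset.mul_sum]
        exact Finset.sum_congr rfl fun i _ => by ring }
  have hΦapp : ∀ p Y, Φ p Y = ∑ i, c p.2 i * Y p.1 i := fun p Y => rfl
  have hΦsingle : ∀ p (κ' : Fin 2) (j : Fin n), Φ p (Matrix.single κ' j (1 : k)) = if p.1 = κ' then c p.2 j else 0 := by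
    intro p κ' j
    rw [hΦapp]
    by_cases h : p.1 = κ'
    · rw [if_pos h, h, Finset.sum_eq_single j]
      · simp
      · intro i _ hi; simp [Ne.symm hi]
      · intro hj; exact absurd (Finset.mem_univ j) hj
    · rw [if_neg h]
      exact Finset.sum_eq_zero fun i _ => by simp [Ne.symm h]
  let G : Submodule k (Module.Dual k (Matrix (Fin 2) (Fin n) k)) := Submodule.span k (Set.range fun s : S => β.g s)
  let W₁ : Submodule k (Module.Dual k (Matrix (Fin 2) (Fin n) k)) := Submodule.span k (Set.range Φ)
  have hle : W₁ ≤ G := by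
    refine Submodule.span_le.mpr ?_
    rintro _ ⟨p, rfl⟩
    obtain ⟨a, ha⟩ := rowForm_eq_sum β ν hν S (c p.2) (fun t ht => hcheap t ht p.2) p.1
    have e : Φ p = ∑ t ∈ S, a t • β.g t := by
      apply LinearMap.ext; intro Y
      rw [hΦapp, ha, LinearMap.sum_apply]
      simp only [LinearMap.smul_apply, smul_eq_mul]
    change Φ p ∈ G
    rw [e]
    exact Submodule.sum_mem _ fun t ht => Submodule.smul_mem _ _ (Submodule.subset_span ⟨⟨t, ht⟩, rfl⟩)
  have hΦ : LinearIndependent k Φ := by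
    rw [Fintype.linearIndependent_iff]
    intro g hg
    have hrow : ∀ κ' : Fin 2, ∑ m, g (κ', m) • c m = 0 := by
      intro κ'
      funext j
      have h := congrArg (fun ψ : Module.Dual k (Matrix (Fin 2) (Fin n) k) => ψ (Matrix.single κ' j (1 : k))) hg
      simp only [LinearMap.sum_apply, LinearMap.smul_apply, LinearMap.zero_apply, smul_eq_mul] at h
      rw [Fintype.sum_prod_type] at h
      simp only [hΦsingle] at h
      rw [Fin.sum_univ_two] at h
      simp only [Pi.zero_apply, Finset.sum_apply, Pi.smul_apply, smul_eq_mul]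
      fin_cases κ'
      · simpa using h
      · simpa using h
    rintro ⟨κ', m'⟩
    exact hind (fun m => g (κ', m)) (hrow κ') m'
  have hW₁ : finrank k W₁ = 4 := by
    rw [finrank_span_eq_card hΦ]; simp
  have hG4 : 4 ≤ finrank k G := by
    rw [← hW₁]; exact Submodule.finrank_mono hle
  rw [linearIndependent_iff_card_le_finrank_span]
  have e : Set.finrank k (Set.range fun s : S => β.g s) = finrank k G := rfl
  rw [e, Fintype.card_coe, hS4]
  exact hG4

end CheapSpans

end Summit.MatrixMultiplication.OmegaCensus.SmallFormats
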